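import Literature.NumberTheory.EllipticCurves.FormalGroupQuasiPeriod
import Mathlib.FieldTheory.IsAlgClosed.AlgebraicClosure
import Mathlib.FieldTheory.Separable
import HarnessLib

/-!
# The η-Hasse invariant: `[z^{p+1}](X·ω) = B_p := [x^{p−2}] Ψ₂²(x)^{(p−1)/2}` in characteristic `p`,
# and `A_p = B_p = 0` is impossible for a non-singular cubic (proofs only)

`Proofs`-style file (THEOREMS ONLY: no definition, no named fact, no instance), topic
`NumberTheory/EllipticCurves`; companion of `FormalGroupHasseInvariantProofs` (Deuring/Hasse:
`[z^{p−1}]ω = A_p := [x^{p−1}]Ψ₂²(x)^{(p−1)/2}`, `Ψ₂² = 4x³ + b₂x² + 2b₄x + b₆`) for the SECOND de Rham class.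

For a Weierstrass equation `W` over a commutative ring `R` of odd prime characteristic `p = 2m + 1`, with
`X = z²x(z)` (`formalXMulSq`), `ω = formalInvDiff` and the differential of the second kind
`x ω = (z⁻² + g_W(z)) dz` (`g_W = formalQuasiPeriodIntegrand`, file `FormalGroupQuasiPeriod`):

* `coeff_formalXMulSq_mul_formalInvDiff_prime_add_one` — **`[z^{p+1}](X·ω) = B_p`**, where
  **`B_p(W) := [x^{p−2}] Ψ₂²(x)^m`** is the "η-Hasse invariant" (the coefficient next to Hasse's
  `A_p = [x^{p−1}]Ψ₂²(x)^m`); equivalently `coeff_formalQuasiPeriodIntegrand_prime_sub_one`: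
  `[z^{p−1}] g_W = B_p`. This is the `z^{p−1}dz`-coefficient of `x ω`, i.e. the constant of the Cartier
  operator `C(x ω) = B_p^{1/p}·ω`, exactly as `A_p` is that of `C(ω) = A_p^{1/p}ω`. PROOF: the Frobenius
  argument of `FormalGroupHasseInvariantProofs` (`ω·Ỹ^p = (zX' − 2X)·Φ^m`, `Ỹ = z³(2y + a₁x + a₃)`,
  `Φ = z⁶Ψ₂²(x)`) multiplied by `X` and read at the exponent `z^{p+1}`: on the left only `ỹ₀^p = (−2)^p`
  survives (`[z¹](X·ω) = 0`), on the right only the monomial `x^{p−2}` of `Ψ₂²(x)^m` (for `k ≠ p − 2`,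
  `(k+2)·[z^e](zX'X^{k+1} − 2X^{k+2}) = (e − 2k − 4)·[z^e]X^{k+2}` with `e ≡ 2k + 4`), contributing `−2·B_p`.
* `coeff_prime_sub_one_pow_ne_zero_or` / **`hasseCoeff_eq_zero_imp_etaHasse_ne_zero`** — over a FIELD of
  characteristic `p ≥ 3`: if `Δ(W) ≠ 0` then `A_p(W)` and `B_p(W)` are not both zero; i.e. at SUPERSINGULAR
  reduction (`A_p = 0`) the η-Hasse invariant is a unit. (Dieudonné-theoretically: `F` and `V` on `H¹_dR(E)`
  have the same kernel when `E` is supersingular, so `V(xω) ≠ 0`; Katz 1981 §5, Colmez 1992 §2.) ELEMENTARY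
  PROOF (new here, pure polynomial algebra): for a separable cubic `Ψ` and `f = Ψ^m`, `p = 2m+1`, the operator
  `L(g) = 2Ψg' + Ψ'g` kills `f` (`L(Ψ^m) = pΨ'Ψ^m`); writing `f = r + x^p·u` with `deg r ≤ p − 3` (this is
  `A_p = B_p = 0`) one gets `L(f) = L(r) + x^p·L(u)` (Frobenius: `(x^p)' = 0`) with `deg L(r) < p`, hence
  `L(r) = L(u) = 0`; but `L(u) = 0`, `u ≠ 0` forces `Ψ ∣ u` and then `2Ψu₁' + 3Ψ'u₁ = 0` for `u = Ψu₁`, …,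
  a descent that only stops at the coefficient `2k+1 ≡ 0 (mod p)`, i.e. after `m` steps — impossible since
  `deg u = m − 1 < 3m` (`descent_of_two_mul_mul_derivative_add`).
* `prime_not_dvd_coeff_formalQuasiPeriodIntegrand_of_hasseCoeff_eq_zero` — the INTEGER form used downstream:
  for `W/ℤ`, `p` odd, `p ∤ Δ_W`, `A_p(W mod p) = 0`: **`p ∤ [z^{p−1}]g_W`** (so, with
  `FormalGroupQuasiPeriodMulDefectCongruenceProofs`, `p ∤ [X^p]R_p`: the η-Hasse hypothesis `htop` of
  `PAdicHodge/AinfWeierstrassEtaHasseCriterion` holds at every odd prime of good supersingular reduction).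

BSD context: crux K★ `stmt-BirchSwinnertonDyer-22226` (hDR at the potentially supersingular cells, input (Nη)).
BSD is not proved by any of this.

## References
* N. M. Katz, *Crystalline cohomology, Dieudonné modules, and Jacobi sums* (1981), §5. [Katz1981CrystallineDieudonne]
* P. Colmez, *Périodes p-adiques des variétés abéliennes*, Math. Ann. 292 (1992), §2. [Colmez1992PeriodesAbeliennes]
* J. H. Silverman, *The Arithmetic of Elliptic Curves*, 2nd ed. (2009), IV.1, V.4.1. [SilvermanAEC2009]
* C. Blakestad, D. Grant, J. Number Theory 249 (2023), Prop. 3 and Remark. [BlakestadGrant2023]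
-/

noncomputable section

open PowerSeries Polynomial Literature.NumberTheory.EllipticCurves

namespace WeierstrassCurve

variable {R : Type*} [CommRing R] (W : WeierstrassCurve R)

/-! ### The coefficient of `z^{p+1}` in `X·(zX' − 2X)·Φ^m` -/

section RightHandSide

variable (p : ℕ) [Fact p.Prime] [CharP R p]

/-- Off the critical exponent: for `k + l = 3m`, `k ≠ p − 2` (`p = 2m+1`),
`[z^{p+1}](X·(zX' − 2X)·X^k z^{2l}) = 0`, because `(k+2)·[z^e](zX'X^{k+1}) = e·[z^e](X^{k+2})` with
`e ≡ 2k + 4 (mod p)` and `k + 2 ∈ Rˣ`. [cite: SilvermanAEC2009, V.4.1] -/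
theorem coeff_formalXMulSq_mul_sub_mul_monomial_eq_zero {m : ℕ} (hpm : p = 2 * m + 1) {k l : ℕ}
    (hkl : k + l = 3 * m) (hk : k ≠ p - 2) :
    PowerSeries.coeff (p + 1) (W.formalXMulSq * (PowerSeries.X * d⁄dX R W.formalXMulSq - 2 * W.formalXMulSq) *
      (W.formalXMulSq ^ k * (PowerSeries.X ^ 2) ^ l)) = 0 := by
  have hp : p.Prime := Fact.out
  set Xs := W.formalXMulSq with hXs
  rw [← pow_mul, show Xs * (PowerSeries.X * d⁄dX R Xs - 2 * Xs) * (Xs ^ k * PowerSeries.X ^ (2 * l)) =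
    ((PowerSeries.X * d⁄dX R Xs * Xs ^ (k + 1) - PowerSeries.C (2 : R) * Xs ^ (k + 2))) * PowerSeries.X ^ (2 * l) by
      rw [map_ofNat]; ring, PowerSeries.coeff_mul_X_pow']
  split_ifs with h2l
  · set e := p + 1 - 2 * l with he
    have heN : e + 2 * l = p + 1 := Nat.sub_add_cancel h2l
    have hnat : e + 2 * p = 2 * k + 4 := by omega
    have hcast : (e : R) = 2 * (k : R) + 4 := by
      have h := congrArg (Nat.cast : ℕ → R) hnat
      push_cast at h
      rw [CharP.cast_eq_zero R p] at h
      linear_combination h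
    have hcd := succ_mul_coeff_X_mul_derivative_mul_pow Xs (k + 1) e
    rw [map_sub, PowerSeries.coeff_C_mul]
    have hk2 : ¬ p ∣ (k + 2) := by
      rintro ⟨c, hc⟩
      rcases Nat.lt_or_ge c 2 with hc2 | hc2
      · interval_cases c
        · omega
        · exact hk (by omega)
      · have : p * c ≥ p * 2 := Nat.mul_le_mul_left p hc2
        have := hp.two_le
        omega
    have hu : IsUnit ((k : R) + 2) := by
      have := isUnit_natCast_of_not_dvd (R := R) p hk2
      push_cast at this
      exact this
    refine (hu.mul_right_eq_zero).mp ?_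
    have hcd' : ((k : R) + 2) * PowerSeries.coeff e (PowerSeries.X * d⁄dX R Xs * Xs ^ (k + 1)) =
        (e : R) * PowerSeries.coeff e (Xs ^ (k + 2)) := by
      rw [← hcd]; push_cast; ring
    linear_combination hcd' + PowerSeries.coeff e (Xs ^ (k + 2)) * hcast
  · rfl

omit [CharP R p] in
/-- At the critical exponent `(k, l) = (p − 2, m + 1)` (`2l = p + 1`):
`[z^{p+1}](X·(zX' − 2X)·X^{p−2} z^{p+1}) = [z⁰](zX'X^{p−1} − 2X^p) = −2`. [cite: SilvermanAEC2009, V.4.1] -/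
theorem coeff_formalXMulSq_mul_sub_mul_monomial_critical {m : ℕ} (hpm : p = 2 * m + 1) :
    PowerSeries.coeff (p + 1) (W.formalXMulSq * (PowerSeries.X * d⁄dX R W.formalXMulSq - 2 * W.formalXMulSq) *
      (W.formalXMulSq ^ (p - 2) * (PowerSeries.X ^ 2) ^ (m + 1))) = -2 := by
  have hp : p.Prime := Fact.out
  set Xs := W.formalXMulSq with hXs
  have hp2 : p - 2 + 2 = p := by have := hp.two_le; omega
  have h2m : 2 * (m + 1) = p + 1 := by omega
  have hX0 : PowerSeries.constantCoeff Xs = 1 := W.constantCoeff_formalXMulSq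
  rw [← pow_mul, h2m, show Xs * (PowerSeries.X * d⁄dX R Xs - 2 * Xs) * (Xs ^ (p - 2) * PowerSeries.X ^ (p + 1)) =
    (Xs * (PowerSeries.X * d⁄dX R Xs - 2 * Xs) * Xs ^ (p - 2)) * PowerSeries.X ^ (p + 1) by ring,
    PowerSeries.coeff_mul_X_pow', if_pos le_rfl, Nat.sub_self, PowerSeries.coeff_zero_eq_constantCoeff]
  simp only [map_mul, map_sub, PowerSeries.constantCoeff_X, zero_mul, zero_sub, map_pow, hX0, one_pow, mul_one,
    one_mul, map_ofNat, mul_neg]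

/-- **`[z^{p+1}](X·(zX' − 2X)·Φ^m) = −2·B_p`** with `B_p = [x^{p−2}]Ψ₂²(x)^m` (`p = 2m + 1`): in
`Φ^m = Σ_{k+l=3m} [xᵏ]Ψ₂²(x)^m · X^k z^{2l}` only the monomial `k = p − 2` survives. [cite: SilvermanAEC2009, V.4.1] -/
theorem coeff_formalXMulSq_mul_sub_mul_phi_pow {m : ℕ} (hpm : p = 2 * m + 1) :
    PowerSeries.coeff (p + 1) (W.formalXMulSq * (PowerSeries.X * d⁄dX R W.formalXMulSq - 2 * W.formalXMulSq) *
      (4 * W.formalXMulSq ^ 3 + PowerSeries.C W.b₂ * PowerSeries.X ^ 2 * W.formalXMulSq ^ 2 +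
        2 * PowerSeries.C W.b₄ * PowerSeries.X ^ 4 * W.formalXMulSq + PowerSeries.C W.b₆ * PowerSeries.X ^ 6) ^ m) =
      -2 * (W.twoTorsionPolynomial.toPoly ^ m).coeff (p - 2) := by
  have hp : p.Prime := Fact.out
  rw [phi_pow_eq_evalXZsq, evalXZsq_eq_sum, Finset.mul_sum, map_sum]
  set F := W.formalXMulSq * (PowerSeries.X * d⁄dX R W.formalXMulSq - 2 * W.formalXMulSq) with hF
  set T := W.twoTorsionPolynomial.toPoly with hT
  set H := (T ^ m).homogenize (3 * m) with hH
  have hterm : ∀ d : Fin 2 →₀ ℕ, PowerSeries.coeff (p + 1)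
      (F * (PowerSeries.C (MvPolynomial.coeff d H) * (W.formalXMulSq ^ d 0 * (PowerSeries.X ^ 2) ^ d 1))) =
        MvPolynomial.coeff d H *
          PowerSeries.coeff (p + 1) (F * (W.formalXMulSq ^ d 0 * (PowerSeries.X ^ 2) ^ d 1)) := by
    intro d
    rw [show F * (PowerSeries.C (MvPolynomial.coeff d H) * (W.formalXMulSq ^ d 0 * (PowerSeries.X ^ 2) ^ d 1)) =
      PowerSeries.C (MvPolynomial.coeff d H) * (F * (W.formalXMulSq ^ d 0 * (PowerSeries.X ^ 2) ^ d 1)) by ring,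
      PowerSeries.coeff_C_mul]
  simp only [hterm]
  set d₀ : Fin 2 →₀ ℕ := Finsupp.single 0 (p - 2) + Finsupp.single 1 (m + 1) with hd₀
  have hd₀0 : d₀ 0 = p - 2 := by simp [hd₀]
  have hd₀1 : d₀ 1 = m + 1 := by simp [hd₀]
  have hcoeff : ∀ d : Fin 2 →₀ ℕ, MvPolynomial.coeff d H =
      if d 0 + d 1 = 3 * m then (T ^ m).coeff (d 0) else 0 := fun d => Polynomial.coeff_homogenize _ _ d
  have hsum : p - 2 + (m + 1) = 3 * m := by have := hp.two_le; omega
  have hB : MvPolynomial.coeff d₀ H = (T ^ m).coeff (p - 2) := by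
    rw [hcoeff, hd₀0, hd₀1, if_pos hsum]
  rw [Finset.sum_eq_single d₀]
  · rw [hB, hd₀0, hd₀1, hF, W.coeff_formalXMulSq_mul_sub_mul_monomial_critical p hpm]
    ring
  · intro b hb hne
    have hb' : MvPolynomial.coeff b H ≠ 0 := MvPolynomial.mem_support_iff.mp hb
    have hsum' : b 0 + b 1 = 3 * m := by
      by_contra h
      rw [hcoeff, if_neg h] at hb'
      exact hb' rfl
    have hk : b 0 ≠ p - 2 := by
      intro h0
      apply hne
      ext i
      fin_cases i
      · simp [hd₀0, h0]
      · simp only [Fin.mk_one, hd₀1]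
        omega
    rw [hF, W.coeff_formalXMulSq_mul_sub_mul_monomial_eq_zero p hpm hsum' hk, mul_zero]
  · intro h
    rw [MvPolynomial.notMem_support_iff.mp h, zero_mul]

end RightHandSide

/-! ### The theorem: `[z^{p+1}](X·ω) = B_p` in characteristic `p` -/

section Main

variable (p : ℕ) [Fact p.Prime] [CharP R p]

/-- **The left-hand side**: `[z^{p+1}]((X·ω)·Ỹ^p) = [z^{p+1}](X·ω) · ỹ₀^p` in characteristic `p`
(`Ỹ^p = Σ ỹⱼ^p z^{jp}` and `[z¹](X·ω) = 0`). [cite: SilvermanAEC2009, V.4.1] -/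
theorem coeff_formalXMulSq_mul_formalInvDiff_mul_formalYTilde_pow_prime :
    PowerSeries.coeff (p + 1) (W.formalXMulSq * W.formalInvDiff * W.formalYTilde ^ p) =
      PowerSeries.coeff (p + 1) (W.formalXMulSq * W.formalInvDiff) * (PowerSeries.coeff 0 W.formalYTilde) ^ p := by
  have hp : p.Prime := Fact.out
  have hdiv : (p + 1) / p = 1 := Nat.div_eq_of_lt_le (by omega) (by have := hp.two_le; omega)
  rw [coeff_mul_pow_prime_eq_sum p, hdiv, Finset.sum_range_succ, Finset.sum_range_succ, Finset.sum_range_zero,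
    zero_add, mul_zero, Nat.sub_zero, mul_one, Nat.add_sub_cancel_left, W.coeff_one_formalXMulSq_mul_formalInvDiff,
    zero_mul, add_zero]

/-- `(−2)^{p−1} = 1` in characteristic `p` odd (Fermat). [folklore] -/
private theorem neg_two_pow_prime_sub_one (hp2 : p ≠ 2) : ((-2 : R)) ^ (p - 1) = 1 := by
  have hp : p.Prime := Fact.out
  have h2 : (-2 : ZMod p) ≠ 0 := by
    rw [Ne, neg_eq_zero]
    intro h
    have h' : ((2 : ℕ) : ZMod p) = 0 := by exact_mod_cast h
    rw [ZMod.natCast_eq_zero_iff] at h'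
    exact hp2 ((Nat.prime_dvd_prime_iff_eq hp Nat.prime_two).mp h')
  have h := congrArg (ZMod.castHom (dvd_refl p) R) (ZMod.pow_card_sub_one_eq_one h2)
  rwa [map_pow, map_neg, map_ofNat, map_one] at h

/-- **`[z^{p+1}](X·ω) = B_p := [x^{p−2}]Ψ₂²(x)^m` in characteristic `p = 2m + 1`** (`W` over any commutative
ring `R` with `CharP R p`, `X = z²x(z)`, `ω = formalInvDiff`, `Ψ₂² = twoTorsionPolynomial`): the η-analogue of
Deuring's `[z^{p−1}]ω = A_p` (`coeff_formalInvDiff_prime_sub_one`). Frobenius argument: the coefficient of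
`z^{p+1}` in `X·ω·Ỹ^p = X·(zX' − 2X)·Φ^m` is `(−2)^p·[z^{p+1}](X·ω)` on the left and `−2·B_p` on the right.
[Katz 1981 §5 (the matrix of `F` on `D(Ê)`); Silverman AEC V.4.1 (method)] [cite: Katz1981CrystallineDieudonne, §5.1] -/
theorem coeff_formalXMulSq_mul_formalInvDiff_prime_add_one (hp2 : p ≠ 2) {m : ℕ} (hpm : p = 2 * m + 1) :
    PowerSeries.coeff (p + 1) (W.formalXMulSq * W.formalInvDiff) = (W.twoTorsionPolynomial.toPoly ^ m).coeff (p - 2) := by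
  have hp : p.Prime := Fact.out
  -- the coefficient of `z^{p+1}` in `X·ω·Ỹ^p = X·(zX' − 2X)·Φ^m`
  have E1 : PowerSeries.coeff (p + 1) (W.formalXMulSq * W.formalInvDiff) * (PowerSeries.coeff 0 W.formalYTilde) ^ p =
      -2 * (W.twoTorsionPolynomial.toPoly ^ m).coeff (p - 2) := by
    rw [← coeff_formalXMulSq_mul_formalInvDiff_mul_formalYTilde_pow_prime, mul_assoc, hpm,
      W.formalInvDiff_mul_formalYTilde_pow m, ← hpm, ← mul_assoc, W.coeff_formalXMulSq_mul_sub_mul_phi_pow p hpm]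
  have hy0 : PowerSeries.coeff 0 W.formalYTilde = -2 := by
    rw [PowerSeries.coeff_zero_eq_constantCoeff_apply, constantCoeff_formalYTilde]
  have hp1 : p = (p - 1) + 1 := (Nat.succ_pred_eq_of_pos hp.pos).symm
  have hpow : ((-2 : R)) ^ p = -2 := by
    rw [hp1, pow_succ, neg_two_pow_prime_sub_one (R := R) p hp2, one_mul]
  rw [hy0, hpow] at E1
  have hunit : IsUnit (-2 : R) := by
    refine IsUnit.neg ?_
    have h2 : ¬ p ∣ 2 := fun h => hp2 ((Nat.prime_dvd_prime_iff_eq hp Nat.prime_two).mp h)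
    have := isUnit_natCast_of_not_dvd (R := R) p h2
    rwa [Nat.cast_ofNat] at this
  have key : (PowerSeries.coeff (p + 1) (W.formalXMulSq * W.formalInvDiff) -
      (W.twoTorsionPolynomial.toPoly ^ m).coeff (p - 2)) * (-2 : R) = 0 := by
    linear_combination E1
  exact sub_eq_zero.mp ((hunit.mul_left_eq_zero).mp key)

/-- **`[z^{p−1}] g_W = B_p`**: the coefficient of `z^{p−1} dz` of the differential of the second kind
`x ω = (z⁻² + g_W)dz` is the η-Hasse invariant `B_p = [x^{p−2}]Ψ₂²(x)^{(p−1)/2}` (characteristic `p` odd).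
[cite: Katz1981CrystallineDieudonne, §5.1] -/
theorem coeff_formalQuasiPeriodIntegrand_prime_sub_one (hp2 : p ≠ 2) :
    PowerSeries.coeff (p - 1) W.formalQuasiPeriodIntegrand =
      (W.twoTorsionPolynomial.toPoly ^ ((p - 1) / 2)).coeff (p - 2) := by
  have hp : p.Prime := Fact.out
  obtain ⟨m, hpm⟩ : ∃ m, p = 2 * m + 1 := hp.odd_of_ne_two hp2
  have hm : (p - 1) / 2 = m := by omega
  rw [coeff_formalQuasiPeriodIntegrand, show p - 1 + 2 = p + 1 by have := hp.two_le; omega, hm,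
    W.coeff_formalXMulSq_mul_formalInvDiff_prime_add_one p hp2 hpm]

end Main

end WeierstrassCurve

/-! ### `A_p = B_p = 0` is impossible for a separable cubic (pure polynomial algebra) -/

namespace Literature.NumberTheory.EllipticCurves

section Descent

variable {K : Type*} [Field K]

/-- **The descent.** For a separable cubic `Ψ` and `v ≠ 0` with `2Ψv' + (2k+1)Ψ'v = 0`: either `2k + 1 = 0`
in `K`, or `Ψ ∣ v` and `v = Ψv₁` with `2Ψv₁' + (2k+3)Ψ'v₁ = 0`; iterating, some `2k' + 1` (`k' ≥ k`) vanishes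
in `K` with `3(k' − k) ≤ deg v`. [folklore] -/
private theorem descent_of_two_mul_mul_derivative_add {Ψ : K[X]} (h3 : Ψ.natDegree = 3)
    (hcop : IsCoprime Ψ (derivative Ψ)) :
    ∀ (n : ℕ) (v : K[X]) (k : ℕ), v ≠ 0 → v.natDegree ≤ n →
      2 * Ψ * derivative v + ((2 * k + 1 : ℕ) : K[X]) * (derivative Ψ * v) = 0 →
        ∃ k' : ℕ, ((2 * k' + 1 : ℕ) : K) = 0 ∧ 3 * k' ≤ n + 3 * k := by
  have hΨ0 : Ψ ≠ 0 := by rintro rfl; simp at h3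
  intro n
  induction n using Nat.strong_induction_on with
  | _ n ih =>
    intro v k hv hdeg heq
    by_cases hc : ((2 * k + 1 : ℕ) : K) = 0
    · exact ⟨k, hc, by omega⟩
    -- `Ψ ∣ Ψ' v`, hence `Ψ ∣ v`
    have hunit : IsUnit (((2 * k + 1 : ℕ) : K[X])) := by
      rw [← map_natCast (Polynomial.C : K →+* K[X])]
      exact Polynomial.isUnit_C.mpr (Ne.isUnit hc)
    have hdvd' : Ψ ∣ ((2 * k + 1 : ℕ) : K[X]) * (derivative Ψ * v) :=
      ⟨-(2 * derivative v), by linear_combination heq⟩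
    have hdvd : Ψ ∣ v * derivative Ψ := by
      rw [mul_comm v]; exact (hunit.dvd_mul_left).mp hdvd'
    obtain ⟨v₁, hv₁⟩ := hcop.dvd_of_dvd_mul_right hdvd
    have hv₁0 : v₁ ≠ 0 := by rintro rfl; exact hv (by rw [hv₁, mul_zero])
    have hdeg₁ : v.natDegree = 3 + v₁.natDegree := by rw [hv₁, Polynomial.natDegree_mul hΨ0 hv₁0, h3]
    have hn3 : v₁.natDegree ≤ n - 3 := by omega
    have hlt : n - 3 < n := by omega
    -- the equation for `v₁`
    have heq₁ : 2 * Ψ * derivative v₁ + ((2 * (k + 1) + 1 : ℕ) : K[X]) * (derivative Ψ * v₁) = 0 := by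
      have h' : Ψ * (2 * Ψ * derivative v₁ + ((2 * (k + 1) + 1 : ℕ) : K[X]) * (derivative Ψ * v₁)) = 0 := by
        rw [hv₁, Polynomial.derivative_mul] at heq
        push_cast at heq ⊢
        linear_combination heq
      exact (mul_eq_zero.mp h').resolve_left hΨ0
    obtain ⟨k', hk', hle⟩ := ih (n - 3) hlt v₁ (k + 1) hv₁0 hn3 heq₁
    exact ⟨k', hk', by omega⟩

/-- **`A_p = B_p = 0` is impossible.** Let `K` be a field of odd characteristic `p = 2m + 1` and `Ψ ∈ K[x]` a
separable cubic (`deg Ψ = 3`, `gcd(Ψ, Ψ') = 1`). Then the coefficients of `x^{p−1}` and `x^{p−2}` of `Ψ^m`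
are not both zero. Proof: `L(g) := 2Ψg' + Ψ'g` has `L(Ψ^m) = pΨ'Ψ^m = 0`; if both coefficients vanish,
`Ψ^m = r + x^p u` with `deg r ≤ p − 3`, `u ≠ 0`, `deg u ≤ m − 1`, and `0 = L(r) + x^p L(u)` with
`deg L(r) < p` forces `L(u) = 0`, contradicting `descent_of_two_mul_mul_derivative_add` (`3m ≤ m − 1`).
(Conceptually: `V(ω) = 0 ⇒ V(xω) ≠ 0` on `H¹_dR` of a supersingular elliptic curve.)
[cite: Katz1981CrystallineDieudonne, §5.1] -/
theorem coeff_pow_prime_sub_one_ne_zero_or {p : ℕ} [Fact p.Prime] [CharP K p] {Ψ : K[X]}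
    (h3 : Ψ.natDegree = 3) (hcop : IsCoprime Ψ (derivative Ψ)) {m : ℕ} (hpm : p = 2 * m + 1) :
    (Ψ ^ m).coeff (p - 1) ≠ 0 ∨ (Ψ ^ m).coeff (p - 2) ≠ 0 := by
  have hp : p.Prime := Fact.out
  by_contra hAB
  rw [not_or, not_not, not_not] at hAB
  obtain ⟨hA, hB⟩ := hAB
  have hΨ0 : Ψ ≠ 0 := by rintro rfl; simp at h3
  obtain ⟨m', rfl⟩ : ∃ m', m = m' + 1 := Nat.exists_eq_add_one_of_ne_zero (by rintro rfl; have := hp.two_le; omega)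
  set f : K[X] := Ψ ^ (m' + 1) with hf
  -- `L(f) = p Ψ' Ψ^m = 0`
  have hLf : 2 * Ψ * derivative f + derivative Ψ * f = 0 := by
    have hpK : ((2 * (m' + 1) + 1 : ℕ) : K[X]) = 0 := by rw [← hpm]; exact CharP.cast_eq_zero K[X] p
    have h : 2 * Ψ * derivative f + derivative Ψ * f = ((2 * (m' + 1) + 1 : ℕ) : K[X]) * (derivative Ψ * f) := by
      rw [hf, Polynomial.derivative_pow, Nat.add_sub_cancel, map_natCast]
      push_cast
      ring
    rw [h, hpK, zero_mul]
  -- the truncation `r` of `f` below degree `p` and the quotient `u`: `f = r + x^p u`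
  set r : K[X] := ∑ j ∈ Finset.range p, Polynomial.C (f.coeff j) * Polynomial.X ^ j with hr
  have hrc : ∀ n, r.coeff n = if n < p then f.coeff n else 0 := by
    intro n
    rw [hr, Polynomial.finsetSum_coeff]
    simp_rw [Polynomial.coeff_C_mul_X_pow]
    rw [Finset.sum_ite_eq]
    simp only [Finset.mem_range]
  have hdvd : (Polynomial.X : K[X]) ^ p ∣ f - r := by
    rw [Polynomial.X_pow_dvd_iff]
    intro d hd
    rw [Polynomial.coeff_sub, hrc, if_pos hd, sub_self]
  obtain ⟨u, hu⟩ := hdvd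
  have hfru : f = r + Polynomial.X ^ p * u := by rw [← hu]; ring
  -- `deg r ≤ p − 3`
  have hrdeg : r.natDegree ≤ p - 3 := by
    rw [Polynomial.natDegree_le_iff_coeff_eq_zero]
    intro N hN
    rw [hrc]
    split_ifs with hNp
    · have : N = p - 1 ∨ N = p - 2 := by omega
      rcases this with rfl | rfl
      exacts [hA, hB]
    · rfl
  -- `u ≠ 0` and `deg u ≤ m − 1`
  have hlead : f.coeff (3 * (m' + 1)) ≠ 0 := by
    rw [hf, show 3 * (m' + 1) = (m' + 1) * Ψ.natDegree by rw [h3]; ring, Polynomial.coeff_pow_mul_natDegree]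
    exact pow_ne_zero _ (Polynomial.leadingCoeff_ne_zero.mpr hΨ0)
  have hu0 : u ≠ 0 := by
    intro h0
    apply hlead
    have h := congrArg (Polynomial.coeff · (3 * (m' + 1))) hfru
    simp only [h0, mul_zero, add_zero] at h
    rw [h, hrc, if_neg (by omega)]
  have hXpu : (Polynomial.X ^ p * u).natDegree = p + u.natDegree := by
    rw [Polynomial.natDegree_mul (pow_ne_zero _ Polynomial.X_ne_zero) hu0, Polynomial.natDegree_X_pow]
  have hudeg : u.natDegree ≤ m' := by
    have h1 : (f - r).natDegree ≤ 3 * (m' + 1) := by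
      refine (Polynomial.natDegree_sub_le _ _).trans (max_le ?_ (by omega))
      rw [hf]
      exact Polynomial.natDegree_pow_le.trans (by rw [h3]; omega)
    rw [hu, hXpu] at h1
    omega
  -- `L(f) = L(r) + x^p · L(u)` (Frobenius: `(x^p)' = 0`)
  have hXp : derivative ((Polynomial.X : K[X]) ^ p) = 0 := by
    rw [Polynomial.derivative_X_pow, CharP.cast_eq_zero K p, map_zero, zero_mul]
  have hL : 2 * Ψ * derivative f + derivative Ψ * f =
      (2 * Ψ * derivative r + derivative Ψ * r) +
        Polynomial.X ^ p * (2 * Ψ * derivative u + derivative Ψ * u) := by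
    rw [hfru, Polynomial.derivative_add, Polynomial.derivative_mul, hXp]
    ring
  -- `deg L(r) < p`
  have hLr_deg : (2 * Ψ * derivative r + derivative Ψ * r).natDegree < p := by
    have hp3 : 3 ≤ p := by omega
    have hΨ' : (derivative Ψ).natDegree ≤ 2 := (Polynomial.natDegree_derivative_le Ψ).trans (by rw [h3])
    have h2Ψ : ((2 : K[X]) * Ψ).natDegree ≤ 3 := by
      rw [show (2 : K[X]) = Polynomial.C (2 : K) by rw [map_ofNat]]
      exact (Polynomial.natDegree_C_mul_le _ _).trans h3.le
    have hB2 : (derivative Ψ * r).natDegree ≤ p - 1 :=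
      (Polynomial.natDegree_mul_le_of_le hΨ' hrdeg).trans (by omega)
    have hA2 : (2 * Ψ * derivative r).natDegree ≤ p - 1 := by
      by_cases hr0 : r.natDegree = 0
      · rw [Polynomial.eq_C_of_natDegree_eq_zero hr0, Polynomial.derivative_C, mul_zero, Polynomial.natDegree_zero]
        exact Nat.zero_le _
      · have hr' : (derivative r).natDegree ≤ p - 4 := by
          have := Polynomial.natDegree_derivative_lt hr0
          omega
        exact (Polynomial.natDegree_mul_le_of_le h2Ψ hr').trans (by omega)
    exact ((Polynomial.natDegree_add_le _ _).trans (max_le hA2 hB2)).trans_lt (by omega)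
  -- hence `L(r) = 0` and `L(u) = 0`
  have hLr : 2 * Ψ * derivative r + derivative Ψ * r = 0 := by
    ext n
    rw [Polynomial.coeff_zero]
    rcases Nat.lt_or_ge n p with hn | hn
    · have h := congrArg (Polynomial.coeff · n) hL
      simp only [hLf, Polynomial.coeff_zero, Polynomial.coeff_add, Polynomial.coeff_X_pow_mul', if_neg (not_le.2 hn),
        add_zero] at h
      exact h.symm
    · exact Polynomial.coeff_eq_zero_of_natDegree_lt (hLr_deg.trans_le hn)
  have hLu : 2 * Ψ * derivative u + derivative Ψ * u = 0 := by
    rw [hLf, hLr, zero_add] at hL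
    exact (mul_eq_zero.mp hL.symm).resolve_left (pow_ne_zero _ Polynomial.X_ne_zero)
  -- the descent from `u`
  have hLu' : 2 * Ψ * derivative u + ((2 * 0 + 1 : ℕ) : K[X]) * (derivative Ψ * u) = 0 := by
    rw [mul_zero, zero_add, Nat.cast_one, one_mul, hLu]
  obtain ⟨k', hk', hle⟩ := descent_of_two_mul_mul_derivative_add h3 hcop m' u 0 hu0 hudeg hLu'
  rw [CharP.cast_eq_zero_iff K p] at hk'
  have := Nat.le_of_dvd (by omega) hk'
  omega

end Descent

/-! ### For a non-singular Weierstrass cubic: `A_p = 0 ⇒ B_p ≠ 0` -/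

section Field

variable {K : Type*} [Field K] {p : ℕ} [Fact p.Prime] [CharP K p]

/-- `Ψ₂² = 4x³ + b₂x² + 2b₄x + b₆` is a separable cubic when `Δ ≠ 0` and `2 ≠ 0`
(`disc Ψ₂² = 16Δ`; distinct roots in `K̄`). [cite: SilvermanAEC2009, III.1.4] -/
theorem isCoprime_twoTorsionPolynomial_derivative (hp2 : p ≠ 2) (W : WeierstrassCurve K) (hΔ : W.Δ ≠ 0) :
    IsCoprime W.twoTorsionPolynomial.toPoly (derivative W.twoTorsionPolynomial.toPoly) := by
  have hp : p.Prime := Fact.out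
  have h2 : (2 : K) ≠ 0 := by
    intro h
    have h' : ((2 : ℕ) : K) = 0 := by exact_mod_cast h
    rw [CharP.cast_eq_zero_iff K p] at h'
    exact hp2 ((Nat.prime_dvd_prime_iff_eq hp Nat.prime_two).mp h')
  have ha : W.twoTorsionPolynomial.a ≠ 0 := by
    change (4 : K) ≠ 0
    rw [show (4 : K) = 2 * 2 by norm_num]
    exact mul_ne_zero h2 h2
  have hdisc : W.twoTorsionPolynomial.discr ≠ 0 :=
    W.twoTorsionPolynomial_discr_ne_zero (Ne.isUnit h2) (Ne.isUnit hΔ)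
  set φ := algebraMap K (AlgebraicClosure K) with hφ
  have hsplit : (W.twoTorsionPolynomial.toPoly.map φ).Splits := IsAlgClosed.splits _
  have hnodup := (Cubic.discr_ne_zero_iff_roots_nodup ha hsplit).mp hdisc
  rw [Cubic.map_roots] at hnodup
  have hne : W.twoTorsionPolynomial.toPoly.map φ ≠ 0 :=
    Polynomial.map_ne_zero (Cubic.ne_zero_of_a_ne_zero ha)
  have hsep : (W.twoTorsionPolynomial.toPoly.map φ).Separable := (Polynomial.nodup_roots_iff_of_splits hne hsplit).mp hnodup
  exact (Polynomial.separable_map φ).mp hsep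

/-- **At supersingular reduction the η-Hasse invariant is a unit.** For a Weierstrass equation `W` over a field
of odd characteristic `p` with `Δ(W) ≠ 0`: if `A_p(W) = 0` (`hasseCoeff`, supersingular) then
`B_p(W) = [x^{p−2}]Ψ₂²(x)^{(p−1)/2} ≠ 0`. (`V` kills `ω`, so `V(xω) ≠ 0` in `H¹_dR(E)`; proved here by the
elementary `coeff_pow_prime_sub_one_ne_zero_or`.) [cite: Katz1981CrystallineDieudonne, §5.1] -/
theorem coeff_twoTorsionPolynomial_pow_ne_zero_of_hasseCoeff_eq_zero (hp2 : p ≠ 2) (W : WeierstrassCurve K)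
    (hΔ : W.Δ ≠ 0) (hA : W.hasseCoeff p = 0) :
    (W.twoTorsionPolynomial.toPoly ^ ((p - 1) / 2)).coeff (p - 2) ≠ 0 := by
  have hp : p.Prime := Fact.out
  obtain ⟨m, hpm⟩ : ∃ m, p = 2 * m + 1 := hp.odd_of_ne_two hp2
  have hm : (p - 1) / 2 = m := by omega
  have h2 : (2 : K) ≠ 0 := by
    intro h
    have h' : ((2 : ℕ) : K) = 0 := by exact_mod_cast h
    rw [CharP.cast_eq_zero_iff K p] at h'
    exact hp2 ((Nat.prime_dvd_prime_iff_eq hp Nat.prime_two).mp h')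
  have ha : W.twoTorsionPolynomial.a ≠ 0 := by
    change (4 : K) ≠ 0
    rw [show (4 : K) = 2 * 2 by norm_num]
    exact mul_ne_zero h2 h2
  have h3 : W.twoTorsionPolynomial.toPoly.natDegree = 3 := Cubic.natDegree_of_a_ne_zero ha
  rw [hm]
  rw [WeierstrassCurve.hasseCoeff, hm] at hA
  exact (coeff_pow_prime_sub_one_ne_zero_or h3 (isCoprime_twoTorsionPolynomial_derivative hp2 W hΔ) hpm).resolve_left
    (not_not.mpr hA)

/-- **`[z^{p−1}] g_W ≠ 0` at supersingular reduction** (field of odd characteristic `p`, `Δ ≠ 0`, `A_p = 0`):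
the `z^{p−1}dz`-coefficient of the differential of the second kind `x ω` is a unit.
[cite: Katz1981CrystallineDieudonne, §5.1] -/
theorem coeff_formalQuasiPeriodIntegrand_ne_zero_of_hasseCoeff_eq_zero (hp2 : p ≠ 2) (W : WeierstrassCurve K)
    (hΔ : W.Δ ≠ 0) (hA : W.hasseCoeff p = 0) :
    PowerSeries.coeff (p - 1) W.formalQuasiPeriodIntegrand ≠ 0 := by
  rw [W.coeff_formalQuasiPeriodIntegrand_prime_sub_one p hp2]
  exact coeff_twoTorsionPolynomial_pow_ne_zero_of_hasseCoeff_eq_zero hp2 W hΔ hA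

end Field

/-! ### The integer form: `p ∤ [z^{p−1}] g_W` at an odd prime of good supersingular reduction -/

/-- **`p ∤ [z^{p−1}]g_W`** for an integral Weierstrass equation `W/ℤ` at an odd prime `p` of good SUPERSINGULAR
reduction (`p ∤ Δ_W`, `A_p(W mod p) = 0`): the η-Hasse invariant of `W mod p` is non-zero and `g_W` commutes
with reduction. With `FormalGroupQuasiPeriodMulDefectCongruenceProofs` (`p ∣ [X^p]R_p + [z^{p−1}]g_W`) this is
the hypothesis `p ∤ [X^p]R_p` of the η-Hasse criterion for the η-period. [cite: Colmez1992PeriodesAbeliennes, §2]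
[cite: Katz1981CrystallineDieudonne, §5.1] -/
theorem prime_not_dvd_coeff_formalQuasiPeriodIntegrand_of_hasseCoeff_eq_zero {p : ℕ} [Fact p.Prime] (hp2 : p ≠ 2)
    (W : WeierstrassCurve ℤ) (hΔ : ¬ (p : ℤ) ∣ W.Δ)
    (hA : (W.map (Int.castRingHom (ZMod p))).hasseCoeff p = 0) :
    ¬ (p : ℤ) ∣ PowerSeries.coeff (p - 1) W.formalQuasiPeriodIntegrand := by
  set π := Int.castRingHom (ZMod p) with hπ
  have hΔ' : (W.map π).Δ ≠ 0 := by
    rw [WeierstrassCurve.map_Δ, hπ, eq_intCast, Ne, ZMod.intCast_zmod_eq_zero_iff_dvd]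
    exact hΔ
  have h := coeff_formalQuasiPeriodIntegrand_ne_zero_of_hasseCoeff_eq_zero hp2 (W.map π) hΔ' hA
  rw [← W.map_formalQuasiPeriodIntegrand π, PowerSeries.coeff_map, hπ, eq_intCast, Ne,
    ZMod.intCast_zmod_eq_zero_iff_dvd] at h
  exact h

end Literature.NumberTheory.EllipticCurves

end
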